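import Summits.QuantumFields.YangMills.Theses.OctaveRunning

/-!
# `LatticeScaleSeed` (stmt-QuantumFields-23712) — negative-lane small-model fact: the one-point torus

Route `OctaveRunning` (planner ym-idea-5), items `LatticeScaleSeed` [23712] and `SubOnsetRunning` [23703] are
stated over the tori of side `2L+1`, `L : ℕ`, restricted only by `Λ ≤ s·L`.  The degenerate torus `L = 0`
(`box 4 0 = {0}`, one site, four links) is admissible whenever `Λ ≤ 0`.  On it the reflected two-point datum of a
POSITIVE-TIME test function vanishes identically, because every summand of `Q2` carries the factor `v 0 = 0`:

  `tsupport v ⊆ {y | 0 < y 0}  →  Q2 G r β 0 s f v = 0`   (any `f`, in particular `f = θv`).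

Consequences recorded for the provers (refuter unit ym-line-or-k1, 2026-08-28):
* the seed's witness in `LatticeScaleSeed` must take `0 < Λ` (with `Λ ≤ 0`, `L = 0` is admissible and forces
  `q₀ ≤ 0`);
* in `SubOnsetRunning` (which quantifies over ALL real `Λ`) the floor hypothesis `q ≤ Q2 … L s (θv) v` for all
  admissible `L` is unsatisfiable with `q > 0` when `Λ ≤ 0` and `v` is positive-time: the octave step is vacuous
  there — harmless for the Assembly, but the intended side condition is `0 < Λ`.
No claim about the Yang–Mills mass gap or about `BalabanLadder.NT` is made here. [folklore]
-/

namespace Summit.QuantumFields.YangMills.Theorems.LatticeScaleSeed.Negative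

open Literature.MathematicalPhysics.QuantumFieldTheory Literature.MathematicalPhysics.QuantumLattice
  Summit.QuantumFields.YangMills.Cruxes.OSLegsFromFemtoAndGap.DlrCollarTransfer

/-- On the one-point torus (`L = 0`) the smeared truncated two-point datum `Q2 … 0 s f v` vanishes for every
positive-time test function `v` (its only summand is `f(0)·v(0)·Var`, and `v 0 = 0`). [folklore] -/
theorem Q2_torusZero_eq_zero (G : Type) [Group G] [TopologicalSpace G] [IsTopologicalGroup G] [CompactSpace G]
    [MeasurableSpace G] [BorelSpace G] (r : LatticeRep G) (β s : ℝ)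
    (f v : SchwartzMap (EuclideanSpace ℝ (Fin 4)) ℝ)
    (hv : tsupport (v : EuclideanSpace ℝ (Fin 4) → ℝ) ⊆ {y : EuclideanSpace ℝ (Fin 4) | 0 < y 0}) :
    Q2 G r β 0 s f v = 0 := by
  have h0 : v 0 = 0 := by
    apply image_eq_zero_of_notMem_tsupport
    intro h
    have h' := hv h
    simp at h'
  unfold Q2
  refine Finset.sum_eq_zero fun x _ => Finset.sum_eq_zero fun y hy => ?_
  have hy0 : y = 0 := by
    unfold Literature.Probability.LatticeModels.box at hy
    rw [Fintype.mem_piFinset] at hy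
    funext i
    simpa using hy i
  subst hy0
  have : siteToE (0 : Fin 4 → ℤ) = 0 := by
    unfold siteToE
    ext i
    simp
  simp [this, h0]

/-- Hence no positive floor survives on the one-point torus: `q₀ ≤ Q2 … 0 s (θv) v` forces `q₀ ≤ 0`
(the `Λ ≤ 0` instance of the seed / of the octave step's floor hypothesis). [folklore] -/
theorem not_pos_floor_torusZero (G : Type) [Group G] [TopologicalSpace G] [IsTopologicalGroup G]
    [CompactSpace G] [MeasurableSpace G] [BorelSpace G] (r : LatticeRep G) (β s q₀ : ℝ)
    (v : SchwartzMap (EuclideanSpace ℝ (Fin 4)) ℝ)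
    (hv : tsupport (v : EuclideanSpace ℝ (Fin 4) → ℝ) ⊆ {y : EuclideanSpace ℝ (Fin 4) | 0 < y 0})
    (hq : q₀ ≤ Q2 G r β 0 s (thetaTest 4 v) v) : q₀ ≤ 0 := by
  simpa [Q2_torusZero_eq_zero G r β s (thetaTest 4 v) v hv] using hq

end Summit.QuantumFields.YangMills.Theorems.LatticeScaleSeed.Negative
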